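import Summits.ResolutionOfSingularities.ResolutionOfSingularities.Theorems.WeightedInvariantLocalWeightedDropNCGameTotality
import Summits.ResolutionOfSingularities.ResolutionOfSingularities.Theorems.WeightedInvariantLocalWeightedDropNCBlocks

/-!
# W4.3 `LocalWeightedDrop` — TOT rung R7b: the CONSUMPTION FORM of the tame relative-binomial rung (4 variables)

OURS · L1 W4.3 · line `nc-game-transport` · strategist res-L1-w43-strat-1 (gen 5) · counted 0 · for verbatim adoption
(`--supports stmt-ResolutionOfSingularities-8899 --as helper`).

R7 (`NCTransport.TOTRungTameBinomial 2`, file `tot_rung_r7_sketch.lean` 785e29c7255c4a72, being landed by res-D-pv-036 as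
`…NCTameBinomialRung` + closer `…NCTameBinomialRungClosed` ⇒ `NCTransport.totRungTameBinomial 2`) says: for `p ∤ d` and non-zero
`E, M, h ∈ k⟦x_0, x_1, x_2⟧` with `E · M · h` finitely NC-winnable, the relative binomial `E · (M · x_3 ^ d + h)` is finitely NC-winnable in
four variables.  By the landed transport `NCTransport.won_of_winsIn` (p507842) every divisor `f` of a power of it is then in the winning
region `CobordantGame.Won k 4` of the weighted game — this is the form the residual stubs of skeleton v31 consume (a START CLASS that
crosses the wild/tame division: `y^p + u·x^α·x_3^c`, `p ∤ c`, has wild order and a tame letter).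

* `won_four_of_tameRelBinom` — CJSB-free: the `x'`-win of `E · M · h` is a hypothesis (discharge it by `winsIn_plane`-cylinders, R2, R5, R6,
  R7-at-`m = 1`, …);
* `won_four_of_tameRelBinom_of_CJSB` — modulo ⟨F-32bR⟩: `htot_two_of_CJSB` supplies the `x'`-win of every non-zero `E · M · h`.

ADOPTION: replace the binder `hR7` by the tree constant `NCTransport.totRungTameBinomial 2` (res-D-pv-036's closer) — the binder's text
is `TOTRungTameBinomial 2` unfolded, so `exact won_four_of_tameRelBinom (totRungTameBinomial 2) …` elaborates by `δ`-reduction.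
-/

noncomputable section

open Literature.AlgebraicGeometry.Resolution

set_option linter.dupNamespace false -- mandated namespace of this single-conjunct summit

namespace Summit.ResolutionOfSingularities.ResolutionOfSingularities.Theorems

namespace NCTransport

open MvPowerSeries TameFourTupleDrop

variable {k : Type} [Field k]

/-- The relative binomial `ι E · (ι M · x_3 ^ d + ι h)` (`ι = rename Fin.castSucc`) is non-zero when `E, M, h ≠ 0` and `d ≠ 0`. -/
theorem relBinom_four_ne_zero {d : ℕ} (hd : d ≠ 0) {E Mx h : MvPowerSeries (Fin 3) k} (hE : E ≠ 0) (hh : h ≠ 0) :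
    rename Fin.castSucc E * (rename Fin.castSucc Mx * X 3 ^ d + rename Fin.castSucc h) ≠
      (0 : MvPowerSeries (Fin 4) k) := by
  have hι : (Fin.castSucc : Fin 3 → Fin 4) = ⇑(Fin.castSuccEmb : Fin 3 ↪ Fin 4) := rfl
  rw [hι]
  refine mul_ne_zero (rename_ne_zero _ hE) fun h0 => hh ?_
  have h3 : (3 : Fin 4) ∉ Set.range (Fin.castSuccEmb : Fin 3 ↪ Fin 4) := by
    rintro ⟨j, hj⟩
    have h1 := congrArg Fin.val hj
    have h2 := j.isLt
    simp at h1
    omega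
  have := congrArg (killCompl (R := k) (Fin.castSuccEmb : Fin 3 ↪ Fin 4)) h0
  rwa [map_add, map_mul, map_pow, killCompl_rename_app, killCompl_rename_app, killCompl_X_eq_zero h3,
    zero_pow hd, mul_zero, zero_add, map_zero] at this

/-- **R7b, CJSB-FREE — TAME RELATIVE BINOMIALS ARE WON IN THE WEIGHTED GAME (4 variables).**  Given the rung R7 at `m = 2`
(binder `hR7` = `TOTRungTameBinomial 2` unfolded; instantiate with `totRungTameBinomial 2`), `p ∤ d`, non-zero
`E, M, h ∈ k⟦x_0, x_1, x_2⟧` whose product the mover wins within finitely many rounds of the count game, EVERY divisor `f` of a power of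
`E · (M · x_3 ^ d + h)` lies in `CobordantGame.Won k 4`. [OURS · L1 W4.3] -/
theorem won_four_of_tameRelBinom
    (hR7 : ∀ (p : ℕ), p.Prime → ∀ (k : Type) [Field k] [CharP k p] [IsAlgClosed k], ∀ (d : ℕ), ¬ p ∣ d →
      ∀ E Mx h : MvPowerSeries (Fin (2 + 1)) k, E ≠ 0 → Mx ≠ 0 → h ≠ 0 →
        (∃ n, WinsIn (m := 2) GermIsNC n (E * Mx * h)) →
        ∃ n, WinsIn (m := 2 + 1) GermIsNC n
          (MvPowerSeries.subst (fun i : Fin (2 + 1) => (X ⟨i.val, by omega⟩ : MvPowerSeries (Fin (2 + 1 + 1)) k)) E *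
            (MvPowerSeries.subst (fun i : Fin (2 + 1) => (X ⟨i.val, by omega⟩ : MvPowerSeries (Fin (2 + 1 + 1)) k)) Mx *
                X ⟨2 + 1, by omega⟩ ^ d +
              MvPowerSeries.subst (fun i : Fin (2 + 1) => (X ⟨i.val, by omega⟩ : MvPowerSeries (Fin (2 + 1 + 1)) k)) h)))
    (p : ℕ) (hp : p.Prime) [CharP k p] [IsAlgClosed k] {d : ℕ} (hpd : ¬ p ∣ d)
    {E Mx h : MvPowerSeries (Fin 3) k} (hE : E ≠ 0) (hMx : Mx ≠ 0) (hh : h ≠ 0)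
    (hwin : ∃ n, WinsIn (m := 2) GermIsNC n (E * Mx * h))
    (N : ℕ) (f : MvPowerSeries (Fin 4) k)
    (hf : f ∣ (rename Fin.castSucc E * (rename Fin.castSucc Mx * X 3 ^ d + rename Fin.castSucc h)) ^ (N + 1)) :
    CobordantGame.Won k 4 f := by
  obtain ⟨n, hn⟩ := hR7 p hp k d hpd E Mx h hE hMx hh hwin
  have hd : d ≠ 0 := by rintro rfl; exact hpd (dvd_zero p)
  have hn' : WinsIn (m := 3) GermIsNC n
      (rename Fin.castSucc E * (rename Fin.castSucc Mx * X 3 ^ d + rename Fin.castSucc h)) := by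
    rw [rename_eq_subst, rename_eq_subst, rename_eq_subst]
    exact hn
  exact won_of_winsIn p hp n _ (relBinom_four_ne_zero hd hE hh) hn' N f hf

/-- **R7b MODULO ⟨F-32bR⟩**: with the Cossart–Jannsen–Saito fact (`htot_two_of_CJSB`: every non-zero germ in three variables is
finitely NC-winnable) the `x'`-win hypothesis disappears: EVERY divisor of a power of a tame relative binomial `E · (M · x_3 ^ d + h)`
(`p ∤ d`; `E, M, h ≠ 0` in `k⟦x_0, x_1, x_2⟧`) is in `CobordantGame.Won k 4`. [OURS · L1 W4.3] -/
theorem won_four_of_tameRelBinom_of_CJSB (hCJS : CossartJannsenSaito2020EmbeddedSequenceB.{0})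
    (hR7 : ∀ (p : ℕ), p.Prime → ∀ (k : Type) [Field k] [CharP k p] [IsAlgClosed k], ∀ (d : ℕ), ¬ p ∣ d →
      ∀ E Mx h : MvPowerSeries (Fin (2 + 1)) k, E ≠ 0 → Mx ≠ 0 → h ≠ 0 →
        (∃ n, WinsIn (m := 2) GermIsNC n (E * Mx * h)) →
        ∃ n, WinsIn (m := 2 + 1) GermIsNC n
          (MvPowerSeries.subst (fun i : Fin (2 + 1) => (X ⟨i.val, by omega⟩ : MvPowerSeries (Fin (2 + 1 + 1)) k)) E *
            (MvPowerSeries.subst (fun i : Fin (2 + 1) => (X ⟨i.val, by omega⟩ : MvPowerSeries (Fin (2 + 1 + 1)) k)) Mx *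
                X ⟨2 + 1, by omega⟩ ^ d +
              MvPowerSeries.subst (fun i : Fin (2 + 1) => (X ⟨i.val, by omega⟩ : MvPowerSeries (Fin (2 + 1 + 1)) k)) h)))
    (p : ℕ) (hp : p.Prime) [CharP k p] [IsAlgClosed k] {d : ℕ} (hpd : ¬ p ∣ d)
    {E Mx h : MvPowerSeries (Fin 3) k} (hE : E ≠ 0) (hMx : Mx ≠ 0) (hh : h ≠ 0)
    (N : ℕ) (f : MvPowerSeries (Fin 4) k)
    (hf : f ∣ (rename Fin.castSucc E * (rename Fin.castSucc Mx * X 3 ^ d + rename Fin.castSucc h)) ^ (N + 1)) :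
    CobordantGame.Won k 4 f :=
  won_four_of_tameRelBinom hR7 p hp hpd hE hMx hh
    (htot_two_of_CJSB hCJS p hp k _ (mul_ne_zero (mul_ne_zero hE hMx) hh)) N f hf

end NCTransport

end Summit.ResolutionOfSingularities.ResolutionOfSingularities.Theorems
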